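import Summits.QuantumFields.YangMills.Theorems.UnitScaleTiltFluctuationComparisonRegPrDualWhitney1DDual

/-!
# Route `UnitScaleTilt` — crux K1bR-pr `FluctuationComparisonRegPr` (stmt-QuantumFields-19201), stub `stub_oneStepSmallLift`
# (W7 line), piece (L1) FOR EVERY ODD BLOCK SIZE: THE THREE-DIMENSIONAL «DUAL WHITNEY» LIFT — an exact, radius-1, local
# right inverse of the linearised (0.4) line average, commuting with the coboundary, with sup-norm gain `8L⁴/(L²+1)³`
# (support file `--supports stmt-QuantumFields-19201`; cell `ym3-torus`, seat `ym3-torus-p1` gen 10; memo HOME/UV3-NODE.md §19)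

Abelian cochain model on `ℤ³` (`Site := Fin 3 → ℤ` for fine AND coarse sites; coarse `y` ↔ fine block `Ly + [−h,h]³`,
`L = 2h+1`; conventions of seat p2's `…CertL3`), cochains valued in a real normed space `E` (`E = 𝔰𝔲(2)` in the use):
* `d1 w z μ ν = w(z;μ) + w(z+e_μ;ν) − w(z+e_ν;μ) − w(z;ν)` (fine or coarse coboundary);
* `Sline w y μ = L⁻³ Σ_{i ∈ [0,L)³} Σ_{t<L} w(Ly − h + i + t e_μ; μ)` — the LINE part of the linearised (0.4) averaged connection
  (IR-NODE §13.1; the contour part is a coarse gradient, free by `ApproxLift.approxLiftStep_of_gauge`);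
* the tensor interpolants `R1 v z μ = L⁻¹ Σ_y Φ₁(z_μ − Ly_μ) Π_{a≠μ} Φ₀(z_a − Ly_a) · v(y;μ)` and
  `R2 c z μ ν = L⁻² Σ_y Φ₁(z_μ−Ly_μ) Φ₁(z_ν−Ly_ν) Φ₀(z_λ−Ly_λ) · c(y;μν)` with the profiles of `…DualWhitney1D` (the sums run
  over a radius-2 window of blocks around `z`; the weights vanish outside radius 1, `wt1_eq_zero`/`wt2_eq_zero`).
PROVED: `Sline_R1` — `S∘R₁ = 1` EXACTLY (every coarse 1-cochain is the line average of its lift: duality of the profiles);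
`d1_R1` — `d₁(R₁v) = R₂(d₁v)` (the lift's fine curvature is the `R₂`-interpolant of the coarse curvature: step identity);
`norm_R2_le` — `‖R₂c(z;μν)‖ ≤ (C³/L²)·M` whenever `‖c‖ ≤ M` pointwise, `C³/L² = 8L⁴/(L²+1)³` (polyphase bounds), hence with
`gain_mul_sqrt_lt_one` the sup-norm gain beats `L^{-1/2}` for every odd `L ≥ 5`.  So `u := R₁v` is a one-step linear lift of `v`
with `S u = v`, fine curvature `d₁u = R₂ d₁v` and `‖d₁u‖_∞ ≤ 8L⁴/(L²+1)³·‖d₁v‖_∞` — the all-`L` closed form asked for by the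
cell (p2 g8 CARD-19201-oneStepSmallLift-L1L2 / IR-NODE §15; numerically validated to 1e-15, kit j259951).  The gauge layer
(`Λ′ = R₁ − d₀K` gauge-blind and still S-exact) is specified in HOME/UV3-NODE.md §19 for the (L2) seat.  Elementary finite sums;
nothing of Bałaban's is asserted.
-/

noncomputable section


namespace Summit.QuantumFields.YangMills.Theorems.DualWhitney

open Finset

/-! ## §7 Sites, blocks, weights, operators -/

/-- Sites of `ℤ³` (used for the fine and for the coarse lattice alike). -/
abbrev Site := Fin 3 → ℤ

variable {E : Type*} [NormedAddCommGroup E] [NormedSpace ℝ E]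
variable (h : ℕ)

/-- The unit vector `e_μ ∈ ℤ³`. -/
def unit (μ : Fin 3) : Site := Pi.single μ 1

/-- `(e_μ)_a = [a = μ]`. -/
theorem unit_apply (μ a : Fin 3) : unit μ a = if a = μ then 1 else 0 := by
  unfold unit; simp [Pi.single_apply]

/-- The coboundary of a 1-cochain: `(d₁w)(z;μν) = w(z;μ) + w(z+e_μ;ν) − w(z+e_ν;μ) − w(z;ν)`. -/
def d1 (w : Site → Fin 3 → E) (z : Site) (μ ν : Fin 3) : E := w z μ + w (z + unit μ) ν - w (z + unit ν) μ - w z ν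

/-- The block index of a fine site (centred blocks `Ly + [−h,h]³`): `blk z a = ⌊(z_a + h)/L⌋`. -/
def blk (z : Site) : Site := fun a => (z a + h) / (bL h : ℤ)

/-- The tensor weight of `R₁`: `Φ₁` in direction `μ`, `Φ₀` in the two other directions, at `z − Ly`. -/
def wt1 (μ : Fin 3) (z y : Site) : ℝ := ∏ a, if a = μ then phi1 h (z a - bL h * y a) else phi0 h (z a - bL h * y a)

/-- The tensor weight of `R₂`: `Φ₁` in directions `μ, ν`, `Φ₀` in the third, at `z − Ly`. -/
def wt2 (μ ν : Fin 3) (z y : Site) : ℝ :=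
  ∏ a, if a = μ ∨ a = ν then phi1 h (z a - bL h * y a) else phi0 h (z a - bL h * y a)

/-- The radius-2 window of blocks around the block of `z` (a superset of the weights' support). -/
def win (z : Site) : Finset Site := Fintype.piFinset fun a => Icc (blk h z a - 2) (blk h z a + 2)

/-- THE DUAL WHITNEY 1-FORM INTERPOLANT `(R₁v)(z;μ) = L⁻¹ Σ_y wt1(z,y) · v(y;μ)`. -/
def R1 (v : Site → Fin 3 → E) (z : Site) (μ : Fin 3) : E := ((bL h : ℝ))⁻¹ • ∑ y ∈ win h z, wt1 h μ z y • v y μ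

/-- THE DUAL WHITNEY 2-FORM INTERPOLANT `(R₂c)(z;μν) = L⁻² Σ_y wt2(z,y) · c(y;μν)`. -/
def R2 (c : Site → Fin 3 → Fin 3 → E) (z : Site) (μ ν : Fin 3) : E :=
  ((bL h : ℝ) ^ 2)⁻¹ • ∑ y ∈ win h z, wt2 h μ ν z y • c y μ ν

/-- The fine site `Ly − h + i + t e_μ` of the averaging geometry (`i ∈ [0,L)³` = position in the block, `t` = step on the line). -/
def apt (y : Site) (μ : Fin 3) (i : Fin 3 → ℕ) (t : ℕ) : Site :=
  fun a => bL h * y a - h + i a + if a = μ then (t : ℤ) else 0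

/-- The box `[0,L)³` of block positions. -/
def box : Finset (Fin 3 → ℕ) := Fintype.piFinset fun _ => range (bL h)

/-- THE LINE AVERAGE `(Sw)(y;μ) = L⁻³ Σ_{i∈[0,L)³} Σ_{t<L} w(Ly − h + i + t e_μ; μ)` (line part of the linearised (0.4) average). -/
def Sline (w : Site → Fin 3 → E) (y : Site) (μ : Fin 3) : E :=
  ((bL h : ℝ) ^ 3)⁻¹ • ∑ i ∈ box h, ∑ t ∈ range (bL h), w (apt h y μ i t) μ

/-! ## §8 Blocks and the support of the weights -/

/-- Every fine coordinate decomposes as `z_a = L·blk(z)_a + r` with `−h ≤ r ≤ h`. -/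
theorem blk_decomp (z : Site) (a : Fin 3) : ∃ r : ℤ, -(h : ℤ) ≤ r ∧ r ≤ h ∧ z a = bL h * blk h z a + r := by
  have hL : (0 : ℤ) < bL h := by rw [bL_int]; omega
  have h1 := Int.mul_ediv_add_emod (z a + h) (bL h)
  have h2 := Int.emod_nonneg (z a + h) hL.ne'
  have h3 := Int.emod_lt_of_pos (z a + h) hL
  refine ⟨(z a + h) % (bL h : ℤ) - h, ?_, ?_, ?_⟩
  · omega
  · rw [bL_int] at h3 ⊢; omega
  · show z a = (bL h : ℤ) * ((z a + h) / (bL h : ℤ)) + ((z a + h) % (bL h : ℤ) - h)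
    omega

/-- A profile factor `Φ₁` or `Φ₀` at `z_a − L y_a` vanishes once `|y_a − blk(z)_a| ≥ 2`. -/
theorem factor_eq_zero {z y : Site} {a : Fin 3} (hy : y a ≤ blk h z a - 2 ∨ blk h z a + 2 ≤ y a) (P : Prop) [Decidable P] :
    (if P then phi1 h (z a - bL h * y a) else phi0 h (z a - bL h * y a)) = 0 := by
  obtain ⟨r, hr1, hr2, hz⟩ := blk_decomp h z a
  have hL := bL_int h
  have hL0 : (0 : ℤ) ≤ bL h := by rw [hL]; omega
  rcases hy with hy | hy
  · have hm : (bL h : ℤ) * 2 ≤ (bL h : ℤ) * (blk h z a - y a) := mul_le_mul_of_nonneg_left (by omega) hL0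
    have : 3 * (h : ℤ) < z a - bL h * y a := by rw [mul_sub] at hm; nlinarith
    split_ifs
    · exact phi1_zeroR this
    · exact phi0_zeroR this
  · have hm : (bL h : ℤ) * 2 ≤ (bL h : ℤ) * (y a - blk h z a) := mul_le_mul_of_nonneg_left (by omega) hL0
    have : z a - bL h * y a < -(3 * (h : ℤ)) := by rw [mul_sub] at hm; nlinarith
    split_ifs
    · exact phi1_zeroL (by omega)
    · exact phi0_zeroL this

/-- The radius-1 box of blocks around the block of `z` — it carries the whole support of the weights at `z`. -/
def supp1 (z : Site) : Finset Site := Fintype.piFinset fun a => Icc (blk h z a - 1) (blk h z a + 1)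

/-- Off the radius-1 box some coordinate is at distance `≥ 2`. -/
theorem exists_far_of_not_mem_supp1 {z y : Site} (hy : y ∉ supp1 h z) :
    ∃ a, y a ≤ blk h z a - 2 ∨ blk h z a + 2 ≤ y a := by
  unfold supp1 at hy
  rw [Fintype.mem_piFinset] at hy
  push Not at hy
  obtain ⟨a, ha⟩ := hy
  rw [mem_Icc, not_and_or] at ha
  exact ⟨a, by omega⟩

/-- `wt1` vanishes off the radius-1 box. -/
theorem wt1_eq_zero (μ : Fin 3) {z y : Site} (hy : y ∉ supp1 h z) : wt1 h μ z y = 0 := by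
  obtain ⟨a, ha⟩ := exists_far_of_not_mem_supp1 h hy
  unfold wt1
  exact prod_eq_zero (mem_univ a) (factor_eq_zero h ha _)

/-- `wt2` vanishes off the radius-1 box. -/
theorem wt2_eq_zero (μ ν : Fin 3) {z y : Site} (hy : y ∉ supp1 h z) : wt2 h μ ν z y = 0 := by
  obtain ⟨a, ha⟩ := exists_far_of_not_mem_supp1 h hy
  unfold wt2
  exact prod_eq_zero (mem_univ a) (factor_eq_zero h ha _)

/-- A sum of `wt1`-weighted terms over any superset of the radius-1 box equals the sum over the box. -/
theorem sum_wt1_subset (μ : Fin 3) {z : Site} {W : Finset Site} (hW : supp1 h z ⊆ W) (g : Site → E) :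
    ∑ y ∈ W, wt1 h μ z y • g y = ∑ y ∈ supp1 h z, wt1 h μ z y • g y := by
  symm
  exact sum_subset hW fun y _ hy => by rw [wt1_eq_zero h μ hy, zero_smul]

/-- The same for `wt2`. -/
theorem sum_wt2_subset (μ ν : Fin 3) {z : Site} {W : Finset Site} (hW : supp1 h z ⊆ W) (g : Site → E) :
    ∑ y ∈ W, wt2 h μ ν z y • g y = ∑ y ∈ supp1 h z, wt2 h μ ν z y • g y := by
  symm
  exact sum_subset hW fun y _ hy => by rw [wt2_eq_zero h μ ν hy, zero_smul]

/-- The radius-2 window contains the radius-1 box. -/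
theorem supp1_subset_win (z : Site) : supp1 h z ⊆ win h z := by
  intro y hy
  unfold supp1 at hy; unfold win
  rw [Fintype.mem_piFinset] at hy ⊢
  intro a; have := hy a; rw [mem_Icc] at this ⊢; omega

/-- `R₁` as a sum over the radius-1 box. -/
theorem R1_eq (v : Site → Fin 3 → E) (z : Site) (μ : Fin 3) :
    R1 h v z μ = ((bL h : ℝ))⁻¹ • ∑ y ∈ supp1 h z, wt1 h μ z y • v y μ := by
  unfold R1; rw [sum_wt1_subset h μ (supp1_subset_win h z)]

/-- `R₂` as a sum over the radius-1 box. -/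
theorem R2_eq (c : Site → Fin 3 → Fin 3 → E) (z : Site) (μ ν : Fin 3) :
    R2 h c z μ ν = ((bL h : ℝ) ^ 2)⁻¹ • ∑ y ∈ supp1 h z, wt2 h μ ν z y • c y μ ν := by
  unfold R2; rw [sum_wt2_subset h μ ν (supp1_subset_win h z)]

/-! ## §9 The sup-norm bound `‖R₂‖_{∞→∞} ≤ C³/L² = 8L⁴/(L²+1)³` -/

/-- A sum over the three-point interval `[b−1, b+1]`. -/
theorem sum_Icc_three (f : ℤ → ℝ) (b : ℤ) : ∑ x ∈ Icc (b - 1) (b + 1), f x = f (b - 1) + f b + f (b + 1) := by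
  have : Icc (b - 1) (b + 1) = {b - 1, b, b + 1} := by
    ext x; simp only [mem_Icc, mem_insert, mem_singleton]; omega
  rw [this, sum_insert (by simp only [mem_insert, mem_singleton]; omega), sum_insert (by simp), sum_singleton]; ring

/-- Per axis, the three live translates of a profile factor have total absolute value `≤ C` (polyphase bounds). -/
theorem axis_abs_sum_le (z : Site) (a : Fin 3) (P : Prop) [Decidable P] :
    ∑ x ∈ Icc (blk h z a - 1) (blk h z a + 1), |(if P then phi1 h (z a - bL h * x) else phi0 h (z a - bL h * x))|
      ≤ cC h := by
  obtain ⟨r, hr1, hr2, hz⟩ := blk_decomp h z a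
  rw [sum_Icc_three]
  have e1 : z a - bL h * (blk h z a - 1) = r + bL h := by rw [hz]; ring
  have e2 : z a - bL h * blk h z a = r := by rw [hz]; ring
  have e3 : z a - bL h * (blk h z a + 1) = r - bL h := by rw [hz]; ring
  rw [e1, e2, e3]
  split_ifs
  · linarith [polyphase_phi1 h hr1 hr2]
  · linarith [polyphase_phi0 h hr1 hr2]

/-- The total absolute weight of `R₂` at any fine plaquette is `≤ C³`. -/
theorem sum_abs_wt2_le (μ ν : Fin 3) (z : Site) : ∑ y ∈ supp1 h z, |wt2 h μ ν z y| ≤ cC h ^ 3 := by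
  have hC := (cC_pos h).le
  calc ∑ y ∈ supp1 h z, |wt2 h μ ν z y|
      = ∑ y ∈ supp1 h z, ∏ a, |(if a = μ ∨ a = ν then phi1 h (z a - bL h * y a) else phi0 h (z a - bL h * y a))| := by
        refine sum_congr rfl fun y _ => ?_
        unfold wt2; exact abs_prod _ _
    _ = ∏ a : Fin 3, ∑ x ∈ Icc (blk h z a - 1) (blk h z a + 1),
          |(if a = μ ∨ a = ν then phi1 h (z a - bL h * x) else phi0 h (z a - bL h * x))| := by
        unfold supp1; rw [prod_univ_sum]
    _ ≤ ∏ _a : Fin 3, cC h := by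
        refine prod_le_prod (fun a _ => sum_nonneg fun x _ => abs_nonneg _) fun a _ => axis_abs_sum_le h z a _
    _ = cC h ^ 3 := by rw [prod_const, card_univ, Fintype.card_fin]

/-- **SUP-NORM BOUND**: if `‖c(y;μν)‖ ≤ M` for all `y`, then `‖(R₂c)(z;μν)‖ ≤ (C³/L²)·M = 8L⁴/(L²+1)³·M` at every fine
plaquette. -/
theorem norm_R2_le (c : Site → Fin 3 → Fin 3 → E) {M : ℝ} (hM : ∀ y, ∀ μ ν : Fin 3, ‖c y μ ν‖ ≤ M) (z : Site) (μ ν : Fin 3) :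
    ‖R2 h c z μ ν‖ ≤ cC h ^ 3 / (bL h : ℝ) ^ 2 * M := by
  have hL := bL_pos h
  have hM0 : 0 ≤ M := (norm_nonneg _).trans (hM 0 0 0)
  rw [R2_eq, norm_smul, norm_inv, norm_pow, Real.norm_of_nonneg hL.le]
  calc ((bL h : ℝ) ^ 2)⁻¹ * ‖∑ y ∈ supp1 h z, wt2 h μ ν z y • c y μ ν‖
      ≤ ((bL h : ℝ) ^ 2)⁻¹ * ∑ y ∈ supp1 h z, |wt2 h μ ν z y| * M := by
        refine mul_le_mul_of_nonneg_left ((norm_sum_le _ _).trans (sum_le_sum fun y _ => ?_)) (by positivity)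
        rw [norm_smul, Real.norm_eq_abs]
        exact mul_le_mul_of_nonneg_left (hM y μ ν) (abs_nonneg _)
    _ = ((bL h : ℝ) ^ 2)⁻¹ * ((∑ y ∈ supp1 h z, |wt2 h μ ν z y|) * M) := by rw [sum_mul]
    _ ≤ ((bL h : ℝ) ^ 2)⁻¹ * (cC h ^ 3 * M) :=
        mul_le_mul_of_nonneg_left (mul_le_mul_of_nonneg_right (sum_abs_wt2_le h μ ν z) hM0) (by positivity)
    _ = cC h ^ 3 / (bL h : ℝ) ^ 2 * M := by ring

/-- The same bound with the gain written as `8L⁴/(L²+1)³`. -/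
theorem norm_R2_le' (c : Site → Fin 3 → Fin 3 → E) {M : ℝ} (hM : ∀ y, ∀ μ ν : Fin 3, ‖c y μ ν‖ ≤ M) (z : Site) (μ ν : Fin 3) :
    ‖R2 h c z μ ν‖ ≤ 8 * (bL h : ℝ) ^ 4 / ((bL h : ℝ) ^ 2 + 1) ^ 3 * M := by
  rw [← gain_eq]; exact norm_R2_le h c hM z μ ν

/-! ## §10 `S ∘ R₁ = 1`: the lift is an EXACT right inverse of the line average -/

/-- Splitting a product over `Fin 3` at the index `μ`. -/
theorem prod_ite_split (μ : Fin 3) (A : ℝ) (B : Fin 3 → ℝ) :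
    (∏ a, if a = μ then A else B a) = A * ∏ a, if a = μ then 1 else B a := by
  rw [Fin.prod_univ_three, Fin.prod_univ_three]
  fin_cases μ <;> simp <;> ring

/-- `Π_{a ≠ μ} L = L²` in the `if`-form. -/
theorem prod_ite_one_L (μ : Fin 3) (X : ℝ) : (∏ a : Fin 3, if a = μ then (1 : ℝ) else X) = X ^ 2 := by
  rw [Fin.prod_univ_three]
  fin_cases μ <;> simp <;> ring

/-- The window of radius 2 around a coarse site `y` itself. -/
def winY (y : Site) : Finset Site := Fintype.piFinset fun a => Icc (y a - 2) (y a + 2)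

/-- `y ∈ winY y`. -/
theorem mem_winY (y : Site) : y ∈ winY y := by
  unfold winY; rw [Fintype.mem_piFinset]; intro a; rw [mem_Icc]; omega

/-- The blocks met by the averaging geometry at `y` lie within one step of `y`: `blk(Ly − h + i + t e_μ)_a ∈ {y_a, y_a + 1}`. -/
theorem blk_apt_mem {y : Site} {μ : Fin 3} {i : Fin 3 → ℕ} {t : ℕ} (hi : i ∈ box h) (ht : t ∈ range (bL h)) (a : Fin 3) :
    y a ≤ blk h (apt h y μ i t) a ∧ blk h (apt h y μ i t) a ≤ y a + 1 := by
  have hL : (0 : ℤ) < bL h := by rw [bL_int]; omega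
  have hia : i a < bL h := by
    unfold box at hi; rw [Fintype.mem_piFinset] at hi; exact mem_range.mp (hi a)
  have ht' : t < bL h := mem_range.mp ht
  set m : ℤ := (i a : ℤ) + (if a = μ then (t : ℤ) else 0) with hm
  have hm0 : 0 ≤ m := by rw [hm]; split_ifs <;> omega
  have hm2 : m < bL h * 2 := by rw [hm]; split_ifs <;> omega
  have hblk : blk h (apt h y μ i t) a = y a + m / (bL h : ℤ) := by
    unfold blk apt
    have : (bL h : ℤ) * y a - h + i a + (if a = μ then (t : ℤ) else 0) + h = m + y a * bL h := by rw [hm]; ring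
    simp only [this]
    rw [Int.add_mul_ediv_right _ _ hL.ne']; ring
  rw [hblk]
  have h1 : 0 ≤ m / (bL h : ℤ) := Int.ediv_nonneg hm0 hL.le
  have h2 : m / (bL h : ℤ) < 2 := Int.ediv_lt_of_lt_mul hL (by linarith)
  constructor <;> omega

/-- Hence the support box at such a point is inside the radius-2 window around `y`. -/
theorem supp1_apt_subset {y : Site} {μ : Fin 3} {i : Fin 3 → ℕ} {t : ℕ} (hi : i ∈ box h) (ht : t ∈ range (bL h)) :
    supp1 h (apt h y μ i t) ⊆ winY y := by
  intro y' hy'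
  unfold supp1 at hy'; unfold winY
  rw [Fintype.mem_piFinset] at hy' ⊢
  intro a
  have h1 := hy' a; have h2 := blk_apt_mem h (y := y) (μ := μ) hi ht a
  rw [mem_Icc] at h1 ⊢; omega

/-- The weights along the averaging geometry at `y`, in product form. -/
theorem wt1_apt (y y' : Site) (μ : Fin 3) (i : Fin 3 → ℕ) (t : ℕ) :
    wt1 h μ (apt h y μ i t) y' =
      ∏ a, if a = μ then phi1 h ((bL h : ℤ) * (y a - y' a) - h + i a + t)
        else phi0 h ((bL h : ℤ) * (y a - y' a) - h + i a) := by
  unfold wt1 apt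
  refine prod_congr rfl fun a _ => ?_
  split_ifs with ha
  · congr 1; ring
  · congr 1; ring

/-- **DUALITY OF THE WEIGHTS**: summed over the averaging geometry at `y`, the weights of `R₁` see only the block `y`:
`Σ_{i∈[0,L)³} Σ_{t<L} wt1(Ly − h + i + t e_μ, y′) = L⁴·[y′ = y]` (`h ≥ 1`). -/
theorem sum_wt1_apt (hh : 1 ≤ h) (y y' : Site) (μ : Fin 3) :
    ∑ i ∈ box h, ∑ t ∈ range (bL h), wt1 h μ (apt h y μ i t) y' = if y' = y then (bL h : ℝ) ^ 4 else 0 := by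
  -- the per-axis one-dimensional sums
  set g : Fin 3 → ℕ → ℝ := fun a k =>
    if a = μ then ∑ t ∈ range (bL h), phi1 h ((bL h : ℤ) * (y a - y' a) - h + k + t)
    else phi0 h ((bL h : ℤ) * (y a - y' a) - h + k) with hg
  have step1 : ∀ i ∈ box h, ∑ t ∈ range (bL h), wt1 h μ (apt h y μ i t) y' = ∏ a, g a (i a) := by
    intro i _
    have e : ∀ t, wt1 h μ (apt h y μ i t) y'
        = phi1 h ((bL h : ℤ) * (y μ - y' μ) - h + i μ + t) * ∏ a, (if a = μ then (1:ℝ) else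
            phi0 h ((bL h : ℤ) * (y a - y' a) - h + i a)) := by
      intro t
      rw [wt1_apt, ← prod_ite_split]
      refine prod_congr rfl fun a _ => ?_
      split_ifs with ha
      · subst ha; rfl
      · rfl
    simp_rw [e]
    rw [← sum_mul]
    have : (∏ a, g a (i a)) = g μ (i μ) * ∏ a, (if a = μ then (1:ℝ) else g a (i a)) := by
      rw [← prod_ite_split]
      refine prod_congr rfl fun a _ => ?_
      split_ifs with ha
      · subst ha; rfl
      · rfl
    rw [this]
    congr 1
    · simp only [hg, if_true]
    · refine prod_congr rfl fun a _ => ?_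
      split_ifs with ha
      · rfl
      · simp only [hg, if_neg ha]
  rw [sum_congr rfl step1]
  -- distribute the box sum over the product
  have step2 : ∑ i ∈ box h, ∏ a, g a (i a) = ∏ a, ∑ k ∈ range (bL h), g a k := by
    unfold box; rw [prod_univ_sum]
  rw [step2]
  -- evaluate the one-dimensional sums by duality
  have step3 : ∀ a, ∑ k ∈ range (bL h), g a k
      = if a = μ then (if y a - y' a = 0 then (bL h : ℝ) ^ 2 else 0) else (if y a - y' a = 0 then (bL h : ℝ) else 0) := by
    intro a
    by_cases ha : a = μ
    · simp only [hg, if_pos ha]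
      rw [← sum_sum_phi1_eq h hh (y a - y' a)]
    · simp only [hg, if_neg ha]
      rw [← sum_phi0_eq h (y a - y' a)]
  simp_rw [step3]
  by_cases hy : y' = y
  · subst hy
    simp only [sub_self, if_true]
    rw [prod_ite_split, prod_ite_one_L]; ring
  · rw [if_neg hy]
    have : ∃ a, y a - y' a ≠ 0 := by
      by_contra hcon
      push Not at hcon
      exact hy (funext fun a => by linarith [hcon a])
    obtain ⟨a, ha⟩ := this
    exact prod_eq_zero (mem_univ a) (by simp [ha])

/-- **`S ∘ R₁ = 1`**: the line average of the dual Whitney lift of `v` is `v` itself, exactly, for every coarse 1-cochain `v`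
(`h ≥ 1`, i.e. `L ≥ 3`). -/
theorem Sline_R1 (hh : 1 ≤ h) (v : Site → Fin 3 → E) (y : Site) (μ : Fin 3) : Sline h (R1 h v) y μ = v y μ := by
  have hL := bL_pos h
  unfold Sline
  have e1 : ∀ i ∈ box h, ∀ t ∈ range (bL h),
      R1 h v (apt h y μ i t) μ = ((bL h : ℝ))⁻¹ • ∑ y' ∈ winY y, wt1 h μ (apt h y μ i t) y' • v y' μ := by
    intro i hi t ht
    rw [R1_eq, ← sum_wt1_subset h μ (supp1_apt_subset h hi ht)]
  rw [sum_congr rfl fun i hi => sum_congr rfl fun t ht => e1 i hi t ht]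
  simp_rw [← smul_sum]
  rw [sum_congr rfl fun i _ => sum_comm, sum_comm]
  simp_rw [← sum_smul]
  rw [sum_congr rfl fun y' _ => by rw [sum_wt1_apt h hh y y' μ]]
  simp_rw [ite_smul, zero_smul]
  rw [sum_ite_eq', if_pos (mem_winY y), smul_smul, smul_smul]
  have : ((bL h : ℝ) ^ 3)⁻¹ * ((bL h : ℝ))⁻¹ * (bL h : ℝ) ^ 4 = 1 := by field_simp
  rw [this, one_smul]

end Summit.QuantumFields.YangMills.Theorems.DualWhitney
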